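import Literature.AlgebraicGeometry.HodgeTheory.SupportedClassesPurity
import Literature.AlgebraicGeometry.HodgeTheory.SupportedClassesAdditivity
import Literature.AlgebraicTopology.SingularHomology.RelativeCohomologyTripleExactness
import Literature.AlgebraicTopology.SingularHomology.RelativeCochainsVanishing
import Literature.AlgebraicTopology.SingularHomology.FundamentalClassExistence

/-!
# Route AmpleAdicLefschetz — `AlgebraicClassesHodgeType`, part 1: the local homology of `X(ℂ)`
# along an irreducible subvariety of codimension `p` is at most a line in degree `2p`

Helper file for item stmt-HodgeConjecture-15189 (`AlgebraicClassesHodgeType`).  For `X` smooth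
projective over `ℂ`, `V ⊆ X` Zariski-closed and irreducible with every point of codimension `≥ p`,
`p ≥ 1`, and `T = V(ℂ) = {P ∈ X(ℂ) | pt P ∈ V}`, the relative homology
`H_{2p}(X(ℂ) | T; ℂ) = H_{2p}(X(ℂ), X(ℂ) ∖ T; ℂ)` is spanned by ONE class (Fulton 1998, §19.1
eq. (3) with Lemma 19.1.1: `H²ᵖ(X, X − V) ≅ H_{2n−2p}(V) = ℂ · [V]`, read through universal
coefficients).  This is the relative form of the tree's purity theorem
`exists_ker_restrictCompl_le_span_of_isIrreducible` (`HodgeTheory/SupportedClassesPurity`, which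
bounds only the IMAGE of that group in `H²ᵖ(X(ℂ))`), by the same mechanism: straighten `V(ℂ)` off
a closed `Z₁ ⊆ V` of codimension `≥ p + 1` (`GAGADimension.exists_closed_straightening_off`); on
`U = (X ∖ Z₁)(ℂ)` the straightened part `S` is closed, connected and locally flat of real
codimension `≥ 2p`, so `H_{2p}(U | S; ℂ)` is a line (the topological Thom class,
`exists_forall_mem_span_localHomologyOfSet_of_locallyFlat`); by universal coefficients for pairs
(`relKroneckerM_bijective_of_field`) so is `H²ᵖ(U, U ∖ S; ℂ)`; the cohomology sequence of the triple
`X(ℂ) ∖ T ⊆ U ⊆ X(ℂ)` (`exists_relSingularCohomology_map_id_eq_of_map_val_eq_zero`) embeds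
`H²ᵖ(X(ℂ), X(ℂ) ∖ T; ℂ)` into it, because `H²ᵖ(X(ℂ), U; ℂ) = 0` by semipurity across `Z₁` (both
halves, `surjective_map_complexPointsCompl_of_le_coheight` /
`injective_map_complexPointsCompl_of_lt_coheight`, and `isZero_relSingularCohomology_succ`); and
universal coefficients for pairs once more give the line in homology, in Mathlib's model
`relativeSingularHomology` and in the concrete model `clocalHomology` of the tree's Čech duality.

Everything here is proved; no definitions, no named facts.
-/

set_option linter.dupNamespace false

noncomputable section

open CategoryTheory CategoryTheory.Limits AlgebraicGeometry Set TopologicalSpace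
open Literature.AlgebraicGeometry Literature.AlgebraicGeometry.HodgeTheory
open Literature.AlgebraicTopology.SingularHomology

namespace Summit.HodgeConjecture.HodgeConjecture.Theorems

/-! ### Linear algebra: modules spanned by one element -/

section Cyclic

variable {F : Type*} [Field F] {V W : Type*} [AddCommGroup V] [Module F V] [AddCommGroup W]
  [Module F W]

/-- A module mapping one-to-one into a module spanned by one element is spanned by one element.
[folklore] -/
theorem exists_forall_eq_smul_of_injective (f : V →ₗ[F] W) (hf : Function.Injective f)
    (hW : ∃ w₀ : W, ∀ w, ∃ t : F, w = t • w₀) : ∃ v₀ : V, ∀ v, ∃ t : F, v = t • v₀ := by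
  obtain ⟨w₀, hw₀⟩ := hW
  by_cases hV : ∀ v : V, v = 0
  · exact ⟨0, fun v ↦ ⟨0, by rw [hV v, zero_smul]⟩⟩
  push Not at hV
  obtain ⟨v₁, hv₁⟩ := hV
  obtain ⟨s, hs⟩ := hw₀ (f v₁)
  have hs0 : s ≠ 0 := by
    rintro rfl
    rw [zero_smul] at hs
    exact hv₁ (hf (by rw [hs, map_zero]))
  refine ⟨v₁, fun v ↦ ?_⟩
  obtain ⟨t, ht⟩ := hw₀ (f v)
  refine ⟨t / s, hf ?_⟩
  rw [map_smul, hs, smul_smul, div_mul_cancel₀ t hs0, ht]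

/-- If the functionals on `W` are (through a surjection) the multiples of one functional, then `W`
is spanned by one element (over a field: a vector space whose dual is at most a line is at most a
line). [folklore] -/
theorem exists_forall_eq_smul_of_dual (κ : V →ₗ[F] (W →ₗ[F] F)) (hκ : Function.Surjective κ)
    (hV : ∃ v₀ : V, ∀ v, ∃ t : F, v = t • v₀) : ∃ w₀ : W, ∀ w, ∃ t : F, w = t • w₀ := by
  obtain ⟨v₀, hv₀⟩ := hV
  -- every functional is a multiple of `φ₀ = κ v₀`
  set φ₀ := κ v₀ with hφ₀
  have hall : ∀ φ : W →ₗ[F] F, ∃ t : F, φ = t • φ₀ := fun φ ↦ by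
    obtain ⟨v, rfl⟩ := hκ φ
    obtain ⟨t, rfl⟩ := hv₀ v
    exact ⟨t, by rw [map_smul]⟩
  by_cases h0 : φ₀ = 0
  · -- all functionals vanish, so `W = 0`
    refine ⟨0, fun w ↦ ⟨0, ?_⟩⟩
    rw [zero_smul]
    refine (Module.forall_dual_apply_eq_zero_iff F w).1 fun φ ↦ ?_
    obtain ⟨t, rfl⟩ := hall φ
    rw [h0, smul_zero, LinearMap.zero_apply]
  · obtain ⟨w₀, hw₀⟩ : ∃ w₀, φ₀ w₀ ≠ 0 := by
      by_contra hall0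
      push Not at hall0
      exact h0 (LinearMap.ext hall0)
    refine ⟨w₀, fun w ↦ ⟨φ₀ w / φ₀ w₀, ?_⟩⟩
    rw [← sub_eq_zero]
    refine (Module.forall_dual_apply_eq_zero_iff F _).1 fun φ ↦ ?_
    obtain ⟨t, rfl⟩ := hall φ
    rw [LinearMap.smul_apply, map_sub, map_smul, smul_eq_mul, smul_eq_mul,
      div_mul_cancel₀ _ hw₀, sub_self, mul_zero]

end Cyclic

/-! ### Relative cohomology of a pair whose relative homology is a line -/

section Pair

variable {Y : Type} [TopologicalSpace Y]

/-- Over a field: if `Hₘ(Y, A)` is spanned by one class then so is `Hᵐ(Y, A)` (universal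
coefficients for the pair, `relKroneckerM_bijective_of_field`). [folklore] -/
theorem exists_forall_eq_smul_relSingularCohomology (A : Set Y) (m : ℕ)
    (h : ∃ θ : relativeSingularHomology ℂ ℂ Y A m, ∀ x, ∃ t : ℂ, x = t • θ) :
    ∃ c₀ : relSingularCohomology ℂ ℂ Y A m, ∀ c, ∃ t : ℂ, c = t • c₀ := by
  obtain ⟨θ, hθ⟩ := h
  by_cases hex : ∃ c' : relSingularCohomology ℂ ℂ Y A m, relKroneckerM ℂ Y A m c' θ ≠ 0
  · obtain ⟨c', hc'⟩ := hex
    exact ⟨c', fun c ↦ exists_smul_eq_of_generator ℂ hθ hc' c⟩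
  · push Not at hex
    refine ⟨0, fun c ↦ ⟨0, ?_⟩⟩
    rw [zero_smul]
    refine (relKroneckerM_bijective_of_field (X := Y) ℂ A m).1 ?_
    rw [map_zero]
    refine LinearMap.ext fun x ↦ ?_
    obtain ⟨t, rfl⟩ := hθ x
    rw [map_smul, hex c, smul_zero, LinearMap.zero_apply]

/-- Over a field: if `Hᵐ(Y, A)` is spanned by one class then so is `Hₘ(Y, A)` (the Kronecker map
`Hᵐ(Y, A) → Hom(Hₘ(Y, A), ℂ)` is onto, and a vector space with at most a line of functionals is at
most a line). [folklore] -/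
theorem exists_forall_eq_smul_relativeSingularHomology (A : Set Y) (m : ℕ)
    (h : ∃ c₀ : relSingularCohomology ℂ ℂ Y A m, ∀ c, ∃ t : ℂ, c = t • c₀) :
    ∃ θ : relativeSingularHomology ℂ ℂ Y A m, ∀ x, ∃ t : ℂ, x = t • θ :=
  exists_forall_eq_smul_of_dual (relKroneckerM ℂ Y A m)
    (relKroneckerM_bijective_of_field (X := Y) ℂ A m).2 h

end Pair

/-! ### The line `H_{2p}(X(ℂ) | V(ℂ); ℂ)` -/

variable {n : ℕ} {X : Motives.SchemeOver ℂ}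

/-- **`H²ᵖ(X(ℂ), (X ∖ Z₁)(ℂ); ℂ) = 0` for `Z₁` Zariski-closed of codimension `≥ p + 1`, `p ≥ 1`**
(semipurity across `Z₁`: `Hⱼ((X ∖ Z₁)(ℂ)) → Hⱼ(X(ℂ))` is onto for `j ≤ 2p + 1` and one-to-one
for `j ≤ 2p`, so `Hⱼ(X(ℂ), (X ∖ Z₁)(ℂ)) = 0` for `j ≤ 2p`, and universal coefficients for the
pair). [cite: VoisinHodgeI2002, §11.1.2 Lemma 11.13] -/
theorem isZero_relSingularCohomology_compl_of_le_coheight (hX : Motives.IsSmoothProjective n X)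
    {Z₁ : Set X.left} (hZ₁ : IsClosed Z₁) {p : ℕ} (hp : 1 ≤ p)
    (hcZ₁ : ∀ z ∈ Z₁, ((p + 1 : ℕ) : ℕ∞) ≤ Order.coheight z) :
    IsZero (relSingularCohomology ℂ ℂ (Motives.ComplexPoints X)
      {P : Motives.ComplexPoints X | P.pt ∉ Z₁} (2 * p)) := by
  -- `Hⱼ(X(ℂ), U) = 0` for `j = 2p` and `j = 2p - 1`
  have hvan : ∀ j, 1 ≤ j → j ≤ 2 * p → IsZero (relativeSingularHomology ℂ ℂ (Motives.ComplexPoints X)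
      {P : Motives.ComplexPoints X | P.pt ∉ Z₁} j) := by
    intro j hj1 hj
    obtain ⟨i, rfl⟩ : ∃ i, j = i + 1 := ⟨j - 1, by omega⟩
    haveI : Epi (singularHomology.map ℂ ℂ
        (subsetIncl {P : Motives.ComplexPoints X | P.pt ∉ Z₁}) (i + 1)) :=
      (ModuleCat.epi_iff_surjective _).2
        (surjective_map_complexPointsCompl_of_le_coheight ℂ ℂ hX hZ₁ hcZ₁ (by omega))
    haveI : Mono (singularHomology.map ℂ ℂ
        (subsetIncl {P : Motives.ComplexPoints X | P.pt ∉ Z₁}) i) :=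
      (ModuleCat.mono_iff_injective _).2
        (injective_map_complexPointsCompl_of_lt_coheight ℂ ℂ hX hZ₁ hcZ₁ (by omega))
    exact isZero_relativeSingularHomology_succ_of_epi_of_mono ℂ ℂ _ i
  obtain ⟨i, hi⟩ : ∃ i, 2 * p = i + 1 := ⟨2 * p - 1, by omega⟩
  rw [hi]
  exact isZero_relSingularCohomology_succ _ (hvan (i + 1) (by omega) (by omega))
    (hvan i (by omega) (by omega))

/-- **The local homology of `X(ℂ)` along `V(ℂ)` is at most a line in degree `2p`** (the relative
form of purity; Fulton 1998, §19.1 eq. (3) and Lemma 19.1.1: `H²ᵖ(X, X − V) ≅ H_{2n−2p}(V)` is a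
line for `V` irreducible of codimension `p`). For `X` smooth projective over `ℂ`, `V ⊆ X`
Zariski-closed and irreducible with every point of codimension `≥ p`, `p ≥ 1`, the relative homology
`H_{2p}(X(ℂ), X(ℂ) ∖ V(ℂ); ℂ)` (Mathlib's model `relativeSingularHomology`) is spanned by one
class. Proof in the module docstring. [cite: Fulton1998, §19.1 Lemma 19.1.1 and eq. (3)]
[cite: VoisinHodgeI2002, §11.1.2 Lemma 11.13 and §11.1.1 Thm. 11.11] -/
theorem exists_forall_eq_smul_relativeSingularHomology_setOf_pt_notMem
    (hX : Motives.IsSmoothProjective n X) {V : Set X.left} (hV : IsClosed V) (hVi : IsIrreducible V)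
    {p : ℕ} (hp : 1 ≤ p) (hpV : ∀ v ∈ V, (p : ℕ∞) ≤ Order.coheight v) :
    ∃ θ : relativeSingularHomology ℂ ℂ (Motives.ComplexPoints X)
        {P : Motives.ComplexPoints X | P.pt ∉ V} (2 * p), ∀ x, ∃ t : ℂ, x = t • θ := by
  -- instances on `X(ℂ)`
  haveI := hX.smoothOfRelativeDimension
  haveI : LocallyOfFiniteType X.hom := by
    haveI : Smooth X.hom := SmoothOfRelativeDimension.smooth n _
    infer_instance
  haveI := Motives.IsSmoothProjective.compactSpace_holds hX
  haveI : SecondCountableTopology (Motives.ComplexPoints X) :=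
    Motives.ComplexPoints.secondCountableTopology_of_compactSpace_holds X
  -- the bad set `Z₁` and the straightening charts off it
  obtain ⟨Z₁, hZ₁, hZ₁V, hcZ₁, hstr⟩ := GAGADimension.exists_closed_straightening_off hX hV hpV
  -- if `V ⊆ Z₁`, every point of `V` has codimension `≥ p + 1` and the group vanishes (semipurity)
  by_cases hVZ : V ⊆ Z₁
  · have hpV' : ∀ v ∈ V, ((p + 1 : ℕ) : ℕ∞) ≤ Order.coheight v := fun v hv ↦ hcZ₁ v (hVZ hv)
    obtain ⟨i, hi⟩ : ∃ i, 2 * p = i + 1 := ⟨2 * p - 1, by omega⟩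
    haveI : Epi (singularHomology.map ℂ ℂ
        (subsetIncl {P : Motives.ComplexPoints X | P.pt ∉ V}) (i + 1)) :=
      (ModuleCat.epi_iff_surjective _).2
        (surjective_map_complexPointsCompl_of_le_coheight ℂ ℂ hX hV hpV' (by omega))
    haveI : Mono (singularHomology.map ℂ ℂ
        (subsetIncl {P : Motives.ComplexPoints X | P.pt ∉ V}) i) :=
      (ModuleCat.mono_iff_injective _).2
        (injective_map_complexPointsCompl_of_lt_coheight ℂ ℂ hX hV hpV' (by omega))
    have hz := isZero_relativeSingularHomology_succ_of_epi_of_mono ℂ ℂ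
      {P : Motives.ComplexPoints X | P.pt ∉ V} i
    rw [← hi] at hz
    haveI := ModuleCat.subsingleton_of_isZero hz
    exact ⟨0, fun x ↦ ⟨0, Subsingleton.elim _ _⟩⟩
  -- the open subspace `U = (X ∖ Z₁)(ℂ)` and its closed subset `S = (V ∖ Z₁)(ℂ)`
  have hO : IsOpen {P : Motives.ComplexPoints X | P.pt ∉ Z₁} :=
    Motives.AlgPoints.isOpen_setOf_pt_mem (X := X) (L := ℂ) ⟨Z₁ᶜ, hZ₁.isOpen_compl⟩
  set S : Set (Motives.complexPointsCompl X Z₁) := {Q | Q.1.pt ∈ V} with hSdef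
  have hS : IsClosed S := by
    have h1 : IsClosed {P : Motives.ComplexPoints X | P.pt ∈ V} :=
      ⟨Motives.AlgPoints.isOpen_setOf_pt_mem (X := X) (L := ℂ) ⟨Vᶜ, hV.isOpen_compl⟩⟩
    exact h1.preimage continuous_subtype_val
  -- `S` is connected: it is `(V ∖ Z₁)(ℂ)` read in the subspace `U`
  have hSc : IsPreconnected S := by
    have hconn := Motives.ComplexPoints.isConnected_setOf_pt_mem_inter_of_isIrreducible X hV hVi
      ⟨Z₁ᶜ, hZ₁.isOpen_compl⟩ (by
        obtain ⟨z, hzV, hzZ⟩ := not_subset.1 hVZ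
        exact ⟨z, hzV, hzZ⟩)
    have himg : (Subtype.val : Motives.complexPointsCompl X Z₁ → Motives.ComplexPoints X) '' S =
        {P : Motives.ComplexPoints X | P.pt ∈ V ∧ P.pt ∈ ((⟨Z₁ᶜ, hZ₁.isOpen_compl⟩ :
          X.left.Opens) : Set X.left)} := by
      ext P
      constructor
      · rintro ⟨Q, hQ, rfl⟩
        exact ⟨hQ, Q.2⟩
      · rintro ⟨hPV, hPZ⟩
        exact ⟨⟨P, hPZ⟩, hPV, rfl⟩
    have hind : Topology.IsInducing
        (Subtype.val : Motives.complexPointsCompl X Z₁ → Motives.ComplexPoints X) := ⟨rfl⟩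
    rw [← hind.isPreconnected_image, himg]
    exact hconn.isPreconnected
  -- local flatness of `S` in `U`, of real codimension `≥ 2p`
  have hflat : ∀ x ∈ S, ∃ (F : Type) (_ : NormedAddCommGroup F) (_ : NormedSpace ℝ F)
      (_ : FiniteDimensional ℝ F) (K : Type) (_ : NormedAddCommGroup K) (_ : NormedSpace ℝ K)
      (e : OpenPartialHomeomorph (Motives.complexPointsCompl X Z₁) (F × K)),
      2 * p ≤ Module.finrank ℝ F ∧ x ∈ e.source ∧ ∀ z ∈ e.source, z ∈ S ↔ (e z).1 = 0 := by
    intro x hx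
    obtain ⟨c', K, e, hcc', hxe, he⟩ := hstr x.1 hx x.2
    let s : Opens (Motives.ComplexPoints X) := ⟨{P | P.pt ∉ Z₁}, hO⟩
    let e' : OpenPartialHomeomorph (Motives.complexPointsCompl X Z₁) ((Fin c' → ℂ) × ↥K) :=
      e.subtypeRestr (s := s) ⟨x⟩
    have he's : e'.source = Subtype.val ⁻¹' e.source := OpenPartialHomeomorph.subtypeRestr_source e ⟨x⟩
    have he'a : ∀ z : Motives.complexPointsCompl X Z₁, e' z = e z.1 := fun z ↦ rfl
    refine ⟨Fin c' → ℂ, inferInstance, inferInstance, inferInstance, ↥K, inferInstance,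
      inferInstance, e', ?_, ?_, fun z hz ↦ ?_⟩
    · have hfr : Module.finrank ℝ (Fin c' → ℂ) = 2 * c' := by
        rw [Module.finrank_pi_fintype, Finset.sum_const, Finset.card_univ, Fintype.card_fin,
          Complex.finrank_real_complex, smul_eq_mul, mul_comm]
      rw [hfr]
      omega
    · rw [he's]
      exact hxe
    · rw [he's] at hz
      rw [he'a]
      exact he z.1 hz
  -- the topological Thom class: `H_{2p}(U | S; ℂ)` is a line
  haveI : SecondCountableTopology (Motives.complexPointsCompl X Z₁) :=
    inferInstanceAs (SecondCountableTopology ↥{P : Motives.ComplexPoints X | P.pt ∉ Z₁})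
  obtain ⟨θ, hθ⟩ := exists_forall_mem_span_localHomologyOfSet_of_locallyFlat ℂ hS hSc (k := 2 * p)
    (by omega) hflat
  -- read `H_{2p}(U | S)` as the relative homology of the pair `(U, U ∩ (X ∖ V)(ℂ))`
  set B' : Set (Motives.ComplexPoints X) := {P | P.pt ∉ V} with hB'
  have hB'U : B' ⊆ {P : Motives.ComplexPoints X | P.pt ∉ Z₁} := fun P hP hPZ ↦ hP (hZ₁V hPZ)
  have hθ' : ∃ θ' : relativeSingularHomology ℂ ℂ (Motives.complexPointsCompl X Z₁)
      (Subtype.val ⁻¹' B') (2 * p), ∀ x, ∃ t : ℂ, x = t • θ' := by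
    refine ⟨θ, fun x ↦ ?_⟩
    obtain ⟨t, ht⟩ := Submodule.mem_span_singleton.1 (hθ x)
    exact ⟨t, ht.symm⟩
  -- so `H²ᵖ(U, U ∩ (X ∖ V)(ℂ); ℂ)` is a line
  have hC'' := exists_forall_eq_smul_relSingularCohomology _ _ hθ'
  -- `H²ᵖ(X(ℂ), (X ∖ V)(ℂ); ℂ)` embeds into it (triple sequence, `H²ᵖ(X(ℂ), U; ℂ) = 0`)
  have hzero := isZero_relSingularCohomology_compl_of_le_coheight hX hZ₁ hp hcZ₁
  have hinj : Function.Injective (relSingularCohomology.map ℂ ℂ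
      (⟨Subtype.val, continuous_subtype_val⟩ :
        C(↥{P : Motives.ComplexPoints X | P.pt ∉ Z₁}, Motives.ComplexPoints X))
      (mapsTo_val_preimage {P : Motives.ComplexPoints X | P.pt ∉ Z₁} B') (2 * p)) := by
    refine (injective_iff_map_eq_zero _).2 fun c hc ↦ ?_
    obtain ⟨c', rfl⟩ := exists_relSingularCohomology_map_id_eq_of_map_val_eq_zero ℂ hB'U _ c hc
    haveI := ModuleCat.subsingleton_of_isZero hzero
    rw [Subsingleton.elim c' 0, map_zero]
  have hC := exists_forall_eq_smul_of_injective _ hinj hC''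
  -- and universal coefficients for pairs give the line in homology
  exact exists_forall_eq_smul_relativeSingularHomology _ _ hC

/-- **The same line in the concrete model** `clocalHomology` of the tree's Čech duality:
`H_{2p}(X(ℂ) | V(ℂ); ℂ)` is spanned by one class (transport along `localHomologyOfSet.cmpIso`).
[cite: Fulton1998, §19.1 Lemma 19.1.1 and eq. (3)] -/
theorem exists_forall_eq_smul_clocalHomology_setOf_pt_mem
    (hX : Motives.IsSmoothProjective n X) {V : Set X.left} (hV : IsClosed V) (hVi : IsIrreducible V)
    {p : ℕ} (hp : 1 ≤ p) (hpV : ∀ v ∈ V, (p : ℕ∞) ≤ Order.coheight v) :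
    ∃ ℓ₀ : clocalHomology ℂ ℂ (Motives.ComplexPoints X) {P : Motives.ComplexPoints X | P.pt ∈ V} (2 * p),
      ∀ ℓ, ∃ t : ℂ, ℓ = t • ℓ₀ := by
  have h := exists_forall_eq_smul_relativeSingularHomology_setOf_pt_notMem hX hV hVi hp hpV
  set e := localHomologyOfSet.cmpIso ℂ ℂ (Motives.ComplexPoints X)
    {P : Motives.ComplexPoints X | P.pt ∈ V} (2 * p) with he
  refine exists_forall_eq_smul_of_injective e.inv.hom e.symm.toLinearEquiv.injective ?_
  exact h

end Summit.HodgeConjecture.HodgeConjecture.Theorems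

end
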